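import Summits.CriticalPhenomena.PercolationContinuityZ3.Theorems.PercNearOneGluingNoHeavyQuantZeroLowHeavy
import Summits.CriticalPhenomena.PercolationContinuityZ3.Theorems.PercNearOneGluingNoHeavyQuantGatedConvSplit
import HarnessLib

/-!
# QUANT lane R8, T-DEC: a law whose only low atom is zero is SDEC at floor `mean / top`; n equal blobs with `Σg ≤ 2` are SDEC at their
# AVERAGE gate — above the natural floor `min gᵢ` (prim-quant-census-2 gen 81)

builds on p205010 (kernel theorem, internal audit signed; external expert review pending)

Support file (`--supports stmt-CriticalPhenomena-4575`), QUANT lane census seat prim-quant-census-2 (gen 81); memo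
`run/shared/lean/prim/quant/prim-quant-census-2-g81/AFL-G81.md` §3 item 11.  Theorems only, standard axioms, no sorries, no definitions.

`SDEC x M μ` (`…QuantSDEC`) asks, for every outer gate `0 < q ≤ 1` and every layer `j′ < M`, that the GATED law `gate μ q = (1−q)δ₀ + q·μ` be
`DECAt (q·x) j′ M`.  Gating a law whose only low atom is `0` keeps that property (the gate only adds mass at `0` and lowers the mean), so the
zero-only-low lemma (`heavy_of_zeroLow`, `…QuantZeroLowHeavy`) applies to every gated copy:

* **`sdec_of_zeroLow`** — ANY probability law `μ` on `{0..M}` with mean `T > 0` and no atom `h` with `0 < h`, `2h < T` is `SDEC (T/M) M μ`.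
* **`sdec_blobLaw_of_mean_le_two`** — `n` blobs of a common size `k` with gates in `[0,1]` and `0 < Σgᵢ ≤ 2`: `blobLaw l` is SDEC at the AVERAGE gate
  `blobMean l / blobTop l = (Σgᵢ)/n` — strictly above the natural floor `min gᵢ` of `sdec_blobLaw` (`…QuantJointBlobHull`) unless all gates agree.
Census (guidance, memo §3 item 11): `n` equal blobs are numerically SDEC at their average gate for EVERY `Σg` (kernel-faithful per-layer flow LP, 0 / ≈ 1 400
laws, `n ≤ 5`); the equal-size hypothesis is essential (unequal sizes fail at `mean/top`, memo §3 item 12).  Conjecture SDEC-AFL (every `Σg`) is open.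

HONEST STATUS.  `SiblingStep`, `FarTreeRow` OPEN; RATE class (log\*) / honest sentence of `run/shared/lean/prim/quant/README.md` unchanged.  [this work].
Nothing here is cited as a published result.  The gluing rows served [cite: KozmaNitzan2024, Conjecture 3 (p. 15)]; product measure
[cite: Grimmett1999, §1.3 p. 10].
-/

noncomputable section

open scoped BigOperators

namespace Summit.CriticalPhenomena.PercolationContinuityZ3.Theorems
namespace Quant

open Finset

namespace LawDec

/-- **A LAW WHOSE ONLY LOW ATOM IS ZERO IS SDEC AT FLOOR `mean / top`.**  For every outer gate `q`, `gate μ q` has mean `qT`, no atom in `(0, qT/2)`,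
and is therefore heavy at `(qT/M, qT)` (`heavy_of_zeroLow`), hence DEC at every layer at floor `q·(T/M)`. [this work] -/
theorem sdec_of_zeroLow (M : ℕ) (μ : ℕ → ℝ) (T : ℝ) (hμ0 : ∀ h, 0 ≤ μ h) (hμM : ∀ h, M < h → μ h = 0)
    (hμ1 : ∑ h ∈ Finset.range (M + 1), μ h = 1) (hmean : ∑ h ∈ Finset.range (M + 1), (h : ℝ) * μ h = T) (hT0 : 0 < T)
    (hlow : ∀ h : ℕ, 0 < h → 2 * (h : ℝ) < T → μ h = 0) :
    SDEC (T / M) M μ := by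
  intro q hq0 hq1 j' _
  obtain ⟨u0, uM, u1⟩ := gate_laws M μ q hq0.le hq1 hμ0 hμM hμ1
  have hmean' : ∑ h ∈ Finset.range (M + 1), (h : ℝ) * gate μ q h = q * T := by rw [sum_mul_gate, hmean]
  have hlow' : ∀ h : ℕ, 0 < h → 2 * (h : ℝ) < q * T → gate μ q h = 0 := by
    intro h hh0 hhT
    have hμh : μ h = 0 := hlow h hh0 (lt_of_lt_of_le hhT (by nlinarith))
    simp only [gate, hμh, mul_zero, zero_add, if_neg (Nat.pos_iff_ne_zero.1 hh0)]
  have hH := heavy_of_zeroLow M (gate μ q) (q * T) u0 uM u1 hmean' (mul_pos hq0 hT0) hlow'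
  have hD := decAtT_of_heavy (q * T / M) (q * T) M (gate μ q) hH j'
  rw [decAt_iff_decAtT, hmean', show q * (T / M) = q * T / M by ring]
  exact hD

/-- **n EQUAL BLOBS WITH `Σgᵢ ≤ 2` ARE SDEC AT THEIR AVERAGE GATE.**  For a blob list `l` with all sizes `= k`, gates in `[0,1]` and
`0 < blobMean l ≤ 2k` (i.e. `0 < Σgᵢ ≤ 2`): `SDEC (blobMean l / blobTop l) (blobTop l) (blobLaw l)` — the floor `(Σgᵢ)/n`, above `min gᵢ`. [this work] -/
theorem sdec_blobLaw_of_mean_le_two (k : ℕ) (l : List (ℕ × ℝ)) (hl : ∀ p ∈ l, p.1 = k ∧ 0 ≤ p.2 ∧ p.2 ≤ 1)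
    (hm0 : 0 < blobMean l) (hm2 : blobMean l ≤ 2 * k) :
    SDEC (blobMean l / blobTop l) (blobTop l) (blobLaw l) :=
  sdec_of_zeroLow (blobTop l) (blobLaw l) (blobMean l) (blobLaw_nonneg l fun p hp => (hl p hp).2)
    (fun h hh => blobLaw_eq_zero l h hh) (sum_blobLaw l) (sum_mul_blobLaw l) hm0
    (fun h hh0 hhT => blobLaw_eq_zero_of_not_dvd k l (fun p hp => by rw [(hl p hp).1]) h (fun hd => by
      have hkh : k ≤ h := Nat.le_of_dvd hh0 hd
      have : (k : ℝ) ≤ h := by exact_mod_cast hkh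
      linarith))

end LawDec
end Quant
end Summit.CriticalPhenomena.PercolationContinuityZ3.Theorems
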